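import Literature.NumberTheory.Sieve.BombieriFriedlanderIwaniecDispersion
import HarnessLib

/-!
# Bombieri–Friedlander–Iwaniec 1986: the bilinear discrepancy, Theorem 0 (b), and Theorem 5* on boxes

Trunk `AntSieve`, companion to `Literature.NumberTheory.Sieve.BombieriFriedlanderIwaniecDispersion`.
That file vendors Theorems 1, 2, 5, 5* of E. Bombieri, J. B. Friedlander, H. Iwaniec, *Primes in
arithmetic progressions to large moduli*, Acta Math. 156 (1986), 203–251, as the leaves under
Theorem 10 (§17).  Working out §§15, 17 in detail (see the blueprint in the companion files) shows
that the derivation of Theorem 10 uses two further inputs of the paper, vendored here as named facts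
(D-0014), together with the common currency of all these statements, the bilinear discrepancy.

* `Literature.BFI.bilinDisc a M N α β d` — the bracket of BFI (3.1) (p. 214) at the modulus `d`:
  `∑_{m∼M, n∼N, mn ≡ a (d)} α_m β_n − φ(d)⁻¹ ∑_{m∼M, n∼N, (mn,d)=1} α_m β_n`; this is the quantity
  `Δ_{α⋆β}(x; d, a)` of (1.1)/(1.5) for the bilinear form `α ⋆ β` of (A₁) (see "Faithfulness").
  PROVED API: `dispD_eq_sum_bilinDisc` (`𝒟 = ∑_{q∼Q, r∼R, (qr,a)=1} γ_q δ_r · bilinDisc (qr)`),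
  linearity and congruence in `α` (`bilinDisc_add_left`, `bilinDisc_smul_left`, `bilinDisc_sub_left`,
  `bilinDisc_congr`), and the same for `𝒟` (`dispD_congr_alpha`, `dispD_smul_alpha`).
* `Literature.NumberTheory.Sieve.BombieriFriedlanderIwaniecTheorem0b` — **Theorem 0 (b)** (§2, p. 211), the Bombieri–Vinogradov
  theorem for general bilinear forms (Y. Motohashi): under (A₁), (A₂), for every `A > 0` there is
  `B₁ > 0` with `∑_{q ≤ Q} max_{(a,q)=1} |Δ_{α⋆β}(x;q,a)| ≪ ‖α‖ ‖β‖ x^{1/2} ℒ^{−A}` for all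
  `Q ≤ x^{1/2} ℒ^{−B₁}`.  It is needed in §17 for the moduli `qr` whose factor `r` is small (the
  range (15.3), p. 244: "in the opposite case the estimate (15.1) follows from the Bombieri mean-value
  theorem").  It is PROVED in the tree from the large sieve inequality
  (`Literature.NumberTheory.Sieve.LargeSieveCharacters`, `largeSieve_character`) along BFI pp. 212–213:
  `Literature.NumberTheory.Sieve.BombieriFriedlanderIwaniecTheorem0b_holds` (companion file
  `…BilinearProofs`); the named-fact form is kept here as the interface its users consume.
* `Literature.NumberTheory.Sieve.BombieriFriedlanderIwaniecTheorem5StarInterval` — **Theorem 5*** (§12, p. 238) in the form in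
  which §15 APPLIES it (p. 246: the variables are localised to boxes `𝓜_i = [(1−Δ)M_i, M_i)` and "we
  shall appeal to Theorems 1, 2, 3, 4 and 5*"): the coefficients (A₆*) restricted to a sub-interval
  `I ⊆ (M, 2M]`, i.e. `α_m = 1_I(m) · 1_{(m,P(z))=1}`.  The literal Theorem 5* is the case `I = (M, 2M]`
  (PROVED: `BombieriFriedlanderIwaniecTheorem5StarInterval.theorem5Star`).  See "Faithfulness".
  STATUS: the tree has since PROVED that this boxed form follows from the printed **Theorem 5**
  (§12, p. 237, `α ≡ 1`, power saving) by the Fundamental-Lemma sieve of p. 238 made effective —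
  `Literature.NumberTheory.Sieve.BombieriFriedlanderIwaniecTheorem5StarInterval_of_theorem5` (file
  `…Theorem5StarFromTheorem5`) — and that Theorem 5 in turn follows from BFI's Lemma 1 in its
  CORRECTED form (Deshouillers–Iwaniec, Invent. Math. 70 (1982), Theorem 12, as corrected in
  Bombieri–Friedlander–Iwaniec, arXiv:1903.01371 (2019), Lemma 2.1; hypothesis
  `BFI.Lemma1BoundCorrected BFI.plateau2 (5/4)` of `…Lemma1Corrected`:
  `…Theorem5StarInterval_of_lemma1corr`).  So this named fact is not independent debt: its
  discharge is the one-liner `…_of_theorem5 ‹Theorem5_holds›` once Theorem 5 (Kuznetsov's formula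
  and the spectral large sieve, in neither Mathlib nor the tree) is proved; the parent statements
  are already routed through Theorem 5 (`bfi_wellFactorable_level_of_theorem1_theorem2_theorem5`,
  `…DispersionLeaves`).

## Faithfulness

* `Δ_f(x;q,a)` is defined in (1.1) (p. 205) with the cutoff `n ≤ x`; for `f = α ⋆ β` with `α` on
  `m ∼ M`, `β` on `n ∼ N`, `MN = x` (A₁) the support of `f` is `(x, 4x]`, and (1.5)/Theorem 0 (b) mean
  the complete bilinear sum — this is what the displayed proof (p. 212: "`Δ_{α⋆β}(x;q,a) =
  φ(q)⁻¹ ∑_{χ ≠ χ₀} χ̄(a) (∑_m α_m χ(m)) (∑_n β_n χ(n))`") treats, and what `bilinDisc` is.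
* "`max_{(a,q)=1}`" is rendered by an arbitrary choice `a : ℕ → ℤ` of residues with `(q, a q) = 1`
  (equivalent to the maximum over the finitely many reduced classes).  As in the companion file the
  constants may depend on `ε` of (A₁), on the exponent `B` and the constants `Csw` of (A₂), and on `A`
  (p. 212: "the implied constants depend on A and on the constant B occurring in (A₂), and in (b) also
  on ε"); we add "for `x ≥ x₀`" (implicit in `≪ ℒ^{−A}`), and coefficients are real.
* Theorem 5* on boxes.  The statement printed on p. 238 has `α_m = 1_{(m,P(z))=1}` on the whole range
  `m ∼ M`.  Its proof (pp. 235–238) begins by replacing `α` by a smooth majorant ((12.1), error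
  `O(‖β‖ N^{1/2} M x^{−ε/2})` by Lemma 3) and never uses more about the range of `m` than its length
  `≍ M`; §15 (p. 246) then applies the theorem with `m` in a box `[(1−Δ)M, M)`, `Δ = ℒ^{−A₁}`.  We
  vendor exactly this applied form — `α_m = 1_{M₁ < m ≤ M₂} · 1_{(m,P(z))=1}` for arbitrary real
  `M₁ ≤ M₂` (only `m ∼ M` matter) — with the conclusion of Theorem 5* as proved on p. 238 (saving
  `ℒ^{−A}`, see the companion file), and record that it is the form USED, not the form PRINTED, of
  Theorem 5*; the printed form follows from it (`…Interval.theorem5Star`).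

## References

* E. Bombieri, J. B. Friedlander, H. Iwaniec, *Primes in arithmetic progressions to large moduli*,
  Acta Math. 156 (1986), 203–251: (1.1), (1.5) p. 205–206; §2 Theorem 0 p. 211–213; §12 Theorem 5*
  p. 238; §15 p. 244–247; §17 p. 249. [BombieriFriedlanderIwaniecActa1986]
* E. Bombieri, J. B. Friedlander, H. Iwaniec, *Some corrections to an old paper*, arXiv:1903.01371
  (2019), §2 Lemma 2.1 (the corrected Lemma 1; see the STATUS paragraph above).
  [BombieriFriedlanderIwaniec2019]
-/

open Finset Real
open scoped ArithmeticFunction.sigma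

namespace Literature.NumberTheory.Sieve

namespace BFI

/-! ### The bilinear discrepancy -/

/-- The bracket of BFI (3.1) at the modulus `d` — the discrepancy `Δ_{α⋆β}(x; d, a)` of (1.1)/(1.5)
for the bilinear form `α ⋆ β` with `α` on `m ∼ M`, `β` on `n ∼ N`:
`∑_{m∼M} ∑_{n∼N, mn ≡ a (mod d)} α_m β_n − φ(d)⁻¹ ∑_{m∼M} ∑_{n∼N, (mn, d) = 1} α_m β_n`.
[cite: BombieriFriedlanderIwaniecActa1986, (1.1) p. 205 and (3.1) p. 214] -/
noncomputable def bilinDisc (a : ℤ) (M N : ℝ) (α β : ℕ → ℝ) (d : ℕ) : ℝ :=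
  (∑ m ∈ dyadic M, ∑ n ∈ dyadic N,
      if ((m * n : ℕ) : ZMod d) = (a : ZMod d) then α m * β n else 0) -
    (∑ m ∈ dyadic M, ∑ n ∈ dyadic N, if (m * n).Coprime d then α m * β n else 0) /
      (Nat.totient d : ℝ)

/-- `𝒟(M,N,Q,R) = ∑_{q∼Q} ∑_{r∼R, (qr,a)=1} γ_q δ_r Δ_{α⋆β}(qr)` (BFI (3.1), p. 214, read through
`bilinDisc`). [cite: BombieriFriedlanderIwaniecActa1986, §3 (3.1) p. 214] -/
theorem dispD_eq_sum_bilinDisc (a : ℤ) (M N Q R : ℝ) (α β γ δ : ℕ → ℝ) :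
    dispD a M N Q R α β γ δ =
      ∑ q ∈ dyadic Q, ∑ r ∈ dyadic R,
        if IsCoprime ((q * r : ℕ) : ℤ) a then γ q * δ r * bilinDisc a M N α β (q * r) else 0 := by
  rfl

/-- `Δ_{α⋆β}(d)` depends only on the values of `α` on `m ∼ M` and of `β` on `n ∼ N`. [folklore] -/
theorem bilinDisc_congr {a : ℤ} {M N : ℝ} {α α' β β' : ℕ → ℝ}
    (hα : ∀ m ∈ dyadic M, α m = α' m) (hβ : ∀ n ∈ dyadic N, β n = β' n) (d : ℕ) :
    bilinDisc a M N α β d = bilinDisc a M N α' β' d := by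
  unfold bilinDisc
  have h1 : ∀ (P : ℕ → ℕ → Prop) [∀ m n, Decidable (P m n)],
      (∑ m ∈ dyadic M, ∑ n ∈ dyadic N, if P m n then α m * β n else 0) =
        ∑ m ∈ dyadic M, ∑ n ∈ dyadic N, if P m n then α' m * β' n else 0 := by
    intro P _
    refine Finset.sum_congr rfl fun m hm => Finset.sum_congr rfl fun n hn => ?_
    rw [hα m hm, hβ n hn]
  rw [h1, h1]

/-- Additivity of `Δ_{α⋆β}(d)` in `α`. [folklore] -/
theorem bilinDisc_add_left (a : ℤ) (M N : ℝ) (α α' β : ℕ → ℝ) (d : ℕ) :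
    bilinDisc a M N (fun m => α m + α' m) β d = bilinDisc a M N α β d + bilinDisc a M N α' β d := by
  unfold bilinDisc
  have h1 : ∀ (P : ℕ → ℕ → Prop) [∀ m n, Decidable (P m n)],
      (∑ m ∈ dyadic M, ∑ n ∈ dyadic N, if P m n then (α m + α' m) * β n else 0) =
        (∑ m ∈ dyadic M, ∑ n ∈ dyadic N, if P m n then α m * β n else 0) +
          ∑ m ∈ dyadic M, ∑ n ∈ dyadic N, if P m n then α' m * β n else 0 := by
    intro P _
    rw [← Finset.sum_add_distrib]
    refine Finset.sum_congr rfl fun m _ => ?_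
    rw [← Finset.sum_add_distrib]
    refine Finset.sum_congr rfl fun n _ => ?_
    split_ifs <;> ring
  rw [h1, h1]
  ring

/-- Homogeneity of `Δ_{α⋆β}(d)` in `α`. [folklore] -/
theorem bilinDisc_smul_left (c : ℝ) (a : ℤ) (M N : ℝ) (α β : ℕ → ℝ) (d : ℕ) :
    bilinDisc a M N (fun m => c * α m) β d = c * bilinDisc a M N α β d := by
  unfold bilinDisc
  have h1 : ∀ (P : ℕ → ℕ → Prop) [∀ m n, Decidable (P m n)],
      (∑ m ∈ dyadic M, ∑ n ∈ dyadic N, if P m n then (c * α m) * β n else 0) =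
        c * ∑ m ∈ dyadic M, ∑ n ∈ dyadic N, if P m n then α m * β n else 0 := by
    intro P _
    rw [Finset.mul_sum]
    refine Finset.sum_congr rfl fun m _ => ?_
    rw [Finset.mul_sum]
    refine Finset.sum_congr rfl fun n _ => ?_
    split_ifs <;> ring
  rw [h1, h1]
  ring

/-- `Δ_{α⋆β}(d)` for the difference of two `α`'s. [folklore] -/
theorem bilinDisc_sub_left (a : ℤ) (M N : ℝ) (α α' β : ℕ → ℝ) (d : ℕ) :
    bilinDisc a M N (fun m => α m - α' m) β d = bilinDisc a M N α β d - bilinDisc a M N α' β d := by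
  have h := bilinDisc_add_left a M N α (fun m => (-1) * α' m) β d
  rw [bilinDisc_smul_left] at h
  simp only [neg_mul, one_mul, ← sub_eq_add_neg] at h
  rw [← h]

/-- Additivity of `Δ_{α⋆β}(d)` in `β`. [folklore] -/
theorem bilinDisc_add_right (a : ℤ) (M N : ℝ) (α β β' : ℕ → ℝ) (d : ℕ) :
    bilinDisc a M N α (fun n => β n + β' n) d = bilinDisc a M N α β d + bilinDisc a M N α β' d := by
  unfold bilinDisc
  have h1 : ∀ (P : ℕ → ℕ → Prop) [∀ m n, Decidable (P m n)],
      (∑ m ∈ dyadic M, ∑ n ∈ dyadic N, if P m n then α m * (β n + β' n) else 0) =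
        (∑ m ∈ dyadic M, ∑ n ∈ dyadic N, if P m n then α m * β n else 0) +
          ∑ m ∈ dyadic M, ∑ n ∈ dyadic N, if P m n then α m * β' n else 0 := by
    intro P _
    rw [← Finset.sum_add_distrib]
    refine Finset.sum_congr rfl fun m _ => ?_
    rw [← Finset.sum_add_distrib]
    refine Finset.sum_congr rfl fun n _ => ?_
    split_ifs <;> ring
  rw [h1, h1]
  ring

/-- Homogeneity of `Δ_{α⋆β}(d)` in `β`. [folklore] -/
theorem bilinDisc_smul_right (c : ℝ) (a : ℤ) (M N : ℝ) (α β : ℕ → ℝ) (d : ℕ) :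
    bilinDisc a M N α (fun n => c * β n) d = c * bilinDisc a M N α β d := by
  unfold bilinDisc
  have h1 : ∀ (P : ℕ → ℕ → Prop) [∀ m n, Decidable (P m n)],
      (∑ m ∈ dyadic M, ∑ n ∈ dyadic N, if P m n then α m * (c * β n) else 0) =
        c * ∑ m ∈ dyadic M, ∑ n ∈ dyadic N, if P m n then α m * β n else 0 := by
    intro P _
    rw [Finset.mul_sum]
    refine Finset.sum_congr rfl fun m _ => ?_
    rw [Finset.mul_sum]
    refine Finset.sum_congr rfl fun n _ => ?_
    split_ifs <;> ring
  rw [h1, h1]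
  ring

/-- With `α = 0` the discrepancy vanishes. [folklore] -/
theorem bilinDisc_zero_left (a : ℤ) (M N : ℝ) (β : ℕ → ℝ) (d : ℕ) :
    bilinDisc a M N (fun _ => 0) β d = 0 := by
  simp [bilinDisc]

/-- `𝒟` depends only on the values of `α` on `m ∼ M`. [folklore] -/
theorem dispD_congr_alpha {a : ℤ} {M : ℝ} (N Q R : ℝ) {α α' : ℕ → ℝ}
    (hα : ∀ m ∈ dyadic M, α m = α' m) (β γ δ : ℕ → ℝ) :
    dispD a M N Q R α β γ δ = dispD a M N Q R α' β γ δ := by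
  rw [dispD_eq_sum_bilinDisc, dispD_eq_sum_bilinDisc]
  refine Finset.sum_congr rfl fun q _ => Finset.sum_congr rfl fun r _ => ?_
  rw [bilinDisc_congr hα (fun _ _ => rfl)]

/-- `𝒟` is homogeneous in `α`. [folklore] -/
theorem dispD_smul_alpha (c : ℝ) (a : ℤ) (M N Q R : ℝ) (α β γ δ : ℕ → ℝ) :
    dispD a M N Q R (fun m => c * α m) β γ δ = c * dispD a M N Q R α β γ δ := by
  rw [dispD_eq_sum_bilinDisc, dispD_eq_sum_bilinDisc, Finset.mul_sum]
  refine Finset.sum_congr rfl fun q _ => ?_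
  rw [Finset.mul_sum]
  refine Finset.sum_congr rfl fun r _ => ?_
  rw [bilinDisc_smul_left]
  split_ifs <;> ring

/-- `𝒟` is additive in `α`. [folklore] -/
theorem dispD_add_alpha (a : ℤ) (M N Q R : ℝ) (α α' β γ δ : ℕ → ℝ) :
    dispD a M N Q R (fun m => α m + α' m) β γ δ =
      dispD a M N Q R α β γ δ + dispD a M N Q R α' β γ δ := by
  rw [dispD_eq_sum_bilinDisc, dispD_eq_sum_bilinDisc, dispD_eq_sum_bilinDisc, ← Finset.sum_add_distrib]
  refine Finset.sum_congr rfl fun q _ => ?_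
  rw [← Finset.sum_add_distrib]
  refine Finset.sum_congr rfl fun r _ => ?_
  rw [bilinDisc_add_left]
  split_ifs <;> ring

end BFI

open BFI

/-! ### Theorem 0 (b): the Bombieri–Vinogradov theorem for bilinear forms -/

/-- **Bombieri–Friedlander–Iwaniec 1986, Theorem 0 (b)** (§2, p. 211; "essentially due to
Y. Motohashi [18]", p. 206): "Let (A₁) and (A₂) hold. For any `A > 0`, there exists `B₁ > 0` such
that `∑_{q ≤ Q} max_{(a,q)=1} |Δ_{α⋆β}(x; q, a)| ≪ ‖α‖ ‖β‖ x^{1/2} ℒ^{−A}` (1.5) for any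
`Q ≤ x^{1/2} ℒ^{−B₁}`.  Here … the implied constants depend on `A` and on the constant `B` occurring in
(A₂), and in (b) also … on the constant `ε` occurring in (A₁)."  Here (A₁) (p. 206) is: `α` on
`m ∼ M = x^{1−ϑ}`, `β` on `n ∼ N = x^ϑ`, `ε ≤ ϑ ≤ 1 − ε`; (A₂) is `Literature.BFI.SiegelWalfiszHyp N B Csw β`;
`Δ_{α⋆β}(x;q,a)` is `Literature.BFI.bilinDisc a M N α β q` and `‖·‖` the `ℓ²`-norm over the dyadic range
(`(Literature.BFI.l2Sq · ·)^{1/2}`).  Rendered (see the module docstring): for `ε > 0`, `A > 0`, `B ≥ 0` and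
constants `Csw` there are `B₁ > 0`, `C`, `x₀` such that for `x ≥ x₀`, all `M N = x` with
`x^ε ≤ N ≤ x^{1−ε}`, every real `β` with (A₂), every real `α`, every `Q ≤ x^{1/2} (log x)^{−B₁}` and
every choice of residues `a_q` with `(q, a_q) = 1`:
`∑_{1 ≤ q ≤ Q} |Δ_{α⋆β}(x; q, a_q)| ≤ C ‖α‖ ‖β‖ x^{1/2} (log x)^{−A}`.
A THEOREM (the multiplicative large sieve inequality, BFI pp. 212–213), PROVED in the tree:
`Literature.NumberTheory.Sieve.BombieriFriedlanderIwaniecTheorem0b_holds` (`…BilinearProofs`); the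
named-fact form below is the interface consumed by `…DyadicLeaves` / `…DispersionLeaves`.
[cite: BombieriFriedlanderIwaniecActa1986, §2 Theorem 0 (b) p. 211] -/
def BombieriFriedlanderIwaniecTheorem0b : Prop :=
  ∀ ε : ℝ, 0 < ε → ∀ A : ℝ, 0 < A → ∀ B : ℝ, 0 ≤ B → ∀ Csw : ℝ → ℝ,
    ∃ B₁ C x₀ : ℝ, 0 < B₁ ∧ ∀ x : ℝ, x₀ ≤ x → ∀ M N : ℝ,
      M * N = x → x ^ ε ≤ N → N ≤ x ^ (1 - ε) →
      ∀ β : ℕ → ℝ, SiegelWalfiszHyp N B Csw β → ∀ α : ℕ → ℝ,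
      ∀ Q : ℝ, Q ≤ x ^ (1 / 2 : ℝ) / Real.log x ^ B₁ →
      ∀ a : ℕ → ℤ, (∀ q : ℕ, IsCoprime (q : ℤ) (a q)) →
        ∑ q ∈ Icc 1 ⌊Q⌋₊, |bilinDisc (a q) M N α β q| ≤
          C * Real.sqrt (l2Sq M α) * Real.sqrt (l2Sq N β) * x ^ (1 / 2 : ℝ) / Real.log x ^ A

/-- The bound of Theorem 0 (b) is `≥ 0` term by term, so the constant may be taken `≥ 0`: a
normalised form with `0 ≤ C`. PROVED (replace `C` by `max C 0`). [folklore] -/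
theorem BombieriFriedlanderIwaniecTheorem0b.nonneg_const (h : BombieriFriedlanderIwaniecTheorem0b)
    {ε : ℝ} (hε : 0 < ε) {A : ℝ} (hA : 0 < A) {B : ℝ} (hB : 0 ≤ B) (Csw : ℝ → ℝ) :
    ∃ B₁ C x₀ : ℝ, 0 < B₁ ∧ 0 ≤ C ∧ ∀ x : ℝ, x₀ ≤ x → ∀ M N : ℝ,
      M * N = x → x ^ ε ≤ N → N ≤ x ^ (1 - ε) →
      ∀ β : ℕ → ℝ, SiegelWalfiszHyp N B Csw β → ∀ α : ℕ → ℝ,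
      ∀ Q : ℝ, Q ≤ x ^ (1 / 2 : ℝ) / Real.log x ^ B₁ →
      ∀ a : ℕ → ℤ, (∀ q : ℕ, IsCoprime (q : ℤ) (a q)) →
        ∑ q ∈ Icc 1 ⌊Q⌋₊, |bilinDisc (a q) M N α β q| ≤
          C * Real.sqrt (l2Sq M α) * Real.sqrt (l2Sq N β) * x ^ (1 / 2 : ℝ) / Real.log x ^ A := by
  obtain ⟨B₁, C, x₀, hB₁, hC⟩ := h ε hε A hA B hB Csw
  refine ⟨B₁, max C 0, max x₀ 1, hB₁, le_max_right _ _, fun x hx M N hMN hN1 hN2 β hβ α Q hQ a ha => ?_⟩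
  have hx₀ : x₀ ≤ x := (le_max_left _ _).trans hx
  have hx1 : 1 ≤ x := (le_max_right _ _).trans hx
  refine (hC x hx₀ M N hMN hN1 hN2 β hβ α Q hQ a ha).trans ?_
  have hlog : 0 ≤ Real.log x := Real.log_nonneg hx1
  refine div_le_div_of_nonneg_right ?_ (by positivity)
  refine mul_le_mul_of_nonneg_right (mul_le_mul_of_nonneg_right
    (mul_le_mul_of_nonneg_right (le_max_left _ _) (Real.sqrt_nonneg _)) (Real.sqrt_nonneg _)) ?_
  positivity

/-! ### Theorem 5* on boxes (the applied form of §15) -/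

/-- **Bombieri–Friedlander–Iwaniec 1986, Theorem 5* as applied in §15** (Theorem 5*: §12, p. 238,
"Theorem 5 holds if (A₆) is replaced by (A₆*) subject to `z ≤ z₀ = exp(log x / log log x)`";
application: §15, p. 246–247, where every variable is restricted to a box `𝓜_i = [(1−Δ)M_i, M_i)`,
`Δ = ℒ^{−A₁}`, and "we shall appeal to Theorems 1, 2, 3, 4 and 5*").  The coefficients are those of
(A₆*) restricted to an interval: `α_m = 1` if `M₁ < m ≤ M₂` and `(m, P(z)) = 1`, `α_m = 0` otherwise
(only `m ∼ M` enter `𝒟`).  Otherwise the statement is `Literature.NumberTheory.Sieve.BombieriFriedlanderIwaniecTheorem5Star`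
verbatim (hypotheses (A₁), (A₃), (12.5), `z ≤ z₀`; conclusion as proved on p. 238, saving `ℒ^{−A}`):
for `a ≠ 0`, `ε > 0`, `A > 0`, `B ≥ 0` there are `C, x₀` such that for `x ≥ x₀`, `MN = x`,
`x^ε ≤ N ≤ x^{1−ε}`, `Q, R ≥ 1/2`, `QR < x`, `x^ε max{Q, x⁻¹QR⁴, Q^{1/2}R, x⁻²Q³R⁴} < M`,
`z ≤ exp(log x / log log x)`, all real `M₁, M₂`, every real `β` and `|γ_q| ≤ τ(q)^B`, `|δ_r| ≤ τ(r)^B`: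
`|𝒟(M,N,Q,R; 1_{(M₁,M₂]} · 1_{(·,P(z))=1}, β, γ, δ)| ≤ C ‖β‖ x^{1/2} M^{1/2} ℒ^{−A}`.
This is the form of Theorem 5* that the proof of Theorem 10 USES; it is not the form PRINTED (which
is the case `(M₁, M₂] ⊇ (M, 2M]`, see `…Interval.theorem5Star`).  The printed proof of Theorem 5
(pp. 235–237) starts from a smooth majorant of `α` ((12.1)) and applies verbatim to any sub-interval
of `(M, 2M]`; we nevertheless flag the discrepancy here rather than silently widening Theorem 5*.
A deep THEOREM (Poisson summation, Deshouillers–Iwaniec bounds, fundamental lemma); not in Mathlib.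
In the tree it is PROVED to follow from the printed Theorem 5
(`Literature.NumberTheory.Sieve.BombieriFriedlanderIwaniecTheorem5StarInterval_of_theorem5`, file
`…Theorem5StarFromTheorem5`), hence from the corrected Lemma 1 (`…Theorem5StarInterval_of_lemma1corr`,
file `…Lemma1Corrected`); see the STATUS paragraph of the module docstring.
[cite: BombieriFriedlanderIwaniecActa1986, §12 Theorem 5* p. 238 and §15 p. 246–247] -/
def BombieriFriedlanderIwaniecTheorem5StarInterval : Prop :=
  ∀ a : ℤ, a ≠ 0 → ∀ ε : ℝ, 0 < ε → ∀ A : ℝ, 0 < A → ∀ B : ℝ, 0 ≤ B →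
    ∃ C x₀ : ℝ, ∀ x : ℝ, x₀ ≤ x → ∀ M N Q R : ℝ,
      M * N = x → x ^ ε ≤ N → N ≤ x ^ (1 - ε) →
      1 / 2 ≤ Q → 1 / 2 ≤ R → Q * R < x →
      x ^ ε * thm5Threshold x Q R < M →
      ∀ z : ℝ, z ≤ Real.exp (Real.log x / Real.log (Real.log x)) →
      ∀ M₁ M₂ : ℝ,
      ∀ β γ δ : ℕ → ℝ, (∀ q, |γ q| ≤ (σ 0 q : ℝ) ^ B) → (∀ r, |δ r| ≤ (σ 0 r : ℝ) ^ B) →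
        |dispD a M N Q R
            (fun m => if M₁ < (m : ℝ) ∧ (m : ℝ) ≤ M₂ then roughIndicator z m else 0) β γ δ| ≤
          C * Real.sqrt (l2Sq N β) * x ^ (1 / 2 : ℝ) * M ^ (1 / 2 : ℝ) / Real.log x ^ A

/-- The applied form implies the printed Theorem 5*: take `(M₁, M₂] = (M, 2M]`, on which the interval
indicator is `1` throughout `m ∼ M` (`Literature.NumberTheory.Sieve.BFI.mem_dyadic`), and use that `𝒟` only sees `α` on
`m ∼ M` (`Literature.NumberTheory.Sieve.BFI.dispD_congr_alpha`).  (The hypotheses of Theorem 5* force `M > 0`.) PROVED.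
[cite: BombieriFriedlanderIwaniecActa1986, §12 Theorem 5* p. 238] -/
theorem BombieriFriedlanderIwaniecTheorem5StarInterval.theorem5Star
    (h : BombieriFriedlanderIwaniecTheorem5StarInterval) : BombieriFriedlanderIwaniecTheorem5Star := by
  intro a ha ε hε A hA B hB
  obtain ⟨C, x₀, hC⟩ := h a ha ε hε A hA B hB
  refine ⟨C, x₀, fun x hx M N Q R hMN hN1 hN2 hQ hR hQR h5 z hz β γ δ hγ hδ => ?_⟩
  have hM : 0 ≤ M := by
    have hQ0 : 0 < Q := by linarith
    have hth : 0 ≤ thm5Threshold x Q R := by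
      unfold thm5Threshold
      exact le_trans hQ0.le (le_trans (le_max_left _ _) (le_max_left _ _))
    have hxpos : 0 < x := lt_of_le_of_lt (by positivity) hQR
    have : 0 ≤ x ^ ε * thm5Threshold x Q R := mul_nonneg (Real.rpow_nonneg hxpos.le _) hth
    linarith
  have hcongr : ∀ m ∈ dyadic M,
      roughIndicator z m = (if M < (m : ℝ) ∧ (m : ℝ) ≤ 2 * M then roughIndicator z m else 0) := by
    intro m hm
    rw [if_pos ((mem_dyadic hM).1 hm)]
  rw [dispD_congr_alpha N Q R hcongr β γ δ]
  exact hC x hx M N Q R hMN hN1 hN2 hQ hR hQR h5 z hz M (2 * M) β γ δ hγ hδ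

end Literature.NumberTheory.Sieve
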